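import Mathlib.Topology.ContinuousMap.Bounded.ArzelaAscoli
import Mathlib.Topology.MetricSpace.Equicontinuity
import Mathlib.Topology.MetricSpace.ProperSpace
import Mathlib.Analysis.Calculus.MeanValue
import Mathlib.Analysis.InnerProductSpace.PiL2
import Mathlib.LinearAlgebra.Multilinear.FiniteDimensional
import Literature.Analysis.Calculus.ContDiffUniformLimit
import HarnessLib

/-!
# Stub `stub_ascoliSmooth` of the line `SketchIdeator2` (card `separatrix-flux-pinning`)
# (crux stmt-AnomalousDissipation-14249, `MarginalStabilityChain.ChainRealisation`)

**Arzelà–Ascoli with all derivatives on the open half-space `(a, ∞) × ℝ³`.** A sequence of `C^∞`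
maps `f n : ℝ × ℝ³ → G` into a finite-dimensional real normed space `G` whose iterated Fréchet
derivatives of every order `m` are bounded on `O = Ioi a ×ˢ univ` uniformly in `n` has a
subsequence converging, together with all derivatives and uniformly on every compact subset of `O`,
to a `C^∞` map `g` obeying the same bounds (Dieudonné 1960, (7.5.7) and (8.6.3)).

Proof.
1. *Equicontinuity* (`ascoli_aux_dist_iteratedFDeriv_le`): on a convex `K ⊆ O` the mean value
   inequality (`Convex.norm_image_sub_le_of_norm_hasFDerivWithin_le`) applied to `D^m (f n)`, whose
   derivative is `D^{m+1} (f n)` curried (tree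
   `Literature.Analysis.Calculus.hasFDerivAt_iteratedFDeriv_of_contDiffOn`), makes `D^m (f n)`
   Lipschitz on `K` with the constant bounding `D^{m+1}`, uniformly in `n`.
2. *Diagonal Arzelà–Ascoli* (`ascoli_aux_extract`, adapted from the tree's
   `Literature.Analysis.FluidPDE.exists_strictMono_tendstoUniformlyOn_of_bound` to countably many
   codomains): for countably many compact sets `T i` and uniformly bounded, uniformly Lipschitz
   families `k ↦ V k i` on them, Mathlib's `BoundedContinuousFunction.arzela_ascoli₂` on each `T i`
   and sequential compactness of the product (Tychonoff) give ONE subsequence converging uniformly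
   on every `T i`.  Indices `i = (m, j)`: derivative order `m`, piece `K j` of the exhaustion
   `K j = [a + 1/(j+2), a + j + 2] × B̄(0, j+2)` of `O`; every compact `K ⊆ O` lies in the open
   core `U j = (a + 1/(j+2), a + j + 2) × B(0, j+2) ⊆ K j` of some piece (`ascoli_aux_exists_subset`).
3. *Smoothness of the limit* (`ascoli_aux_general`): the pointwise limits `p x m` of
   `D^m (f (φ n)) x` are uniform limits on every `K j`, hence on every open `U j`, where the tree's
   `ContDiffUniformLimit` file (`contDiffOn_of_tendstoUniformlyOn_iteratedFDeriv`,
   `tendstoUniformlyOn_iteratedFDeriv_of_tendstoUniformlyOn`,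
   `norm_iteratedFDeriv_le_of_tendstoUniformlyOn`) shows that `g = p · 0` is `C^∞` with
   `D^m g = p · m = lim D^m (f (φ n))` and `‖D^m g‖ ≤ C m`; `ContDiffOn` and the bounds are local,
   and the convergence on a compact `K ⊆ U j` is the restriction of that on `U j`.

The statement is the registered stub verbatim (pure Mathlib calculus: `iteratedFDeriv`,
`ContDiffOn ℝ (⊤ : ℕ∞)`, `TendstoUniformlyOn` for the operator norm on continuous multilinear maps).

References: J. Dieudonné, *Foundations of Modern Analysis* (1960), (7.5.7), (8.6.3);
Mathlib `BoundedContinuousFunction.arzela_ascoli₂`.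
-/

-- `Summit.<Summit>.<Problem>` is the tree's mandated summit-side namespace (CONVENTIONS §2); for this
-- single-conjunct summit the two coincide, so the duplicate is deliberate.
set_option linter.dupNamespace false

noncomputable section

open Set Filter Topology Metric Function
open scoped BoundedContinuousFunction NNReal

namespace Summit.AnomalousDissipation.AnomalousDissipation.Theorems.ChainRealisation.SeparatrixFluxPinning

/-! ### Finite-dimensionality of the spaces of derivatives -/

/-- Continuous multilinear maps between finite-dimensional real normed spaces form a
finite-dimensional space (they embed linearly in all multilinear maps). -/
theorem ascoli_aux_finiteDimensional {ι : Type*} [Fintype ι] {K F : Type*}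
    [NormedAddCommGroup K] [NormedSpace ℝ K] [FiniteDimensional ℝ K]
    [NormedAddCommGroup F] [NormedSpace ℝ F] [FiniteDimensional ℝ F] :
    FiniteDimensional ℝ (ContinuousMultilinearMap ℝ (fun _ : ι => K) F) :=
  -- adapted from Literature.Geometry.GeometricMeasureTheory.finiteDimensional_continuousMultilinearMap
  Module.Finite.of_injective
    (ContinuousMultilinearMap.toMultilinearMapLinear :
      ContinuousMultilinearMap ℝ (fun _ : ι => K) F →ₗ[ℝ] MultilinearMap ℝ (fun _ : ι => K) F)
    fun _ _ h => ContinuousMultilinearMap.toMultilinearMap_injective h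

/-! ### Diagonal Arzelà–Ascoli extraction -/

/-- **Diagonal Arzelà–Ascoli extraction** over countably many compact sets and codomains: if for
every index `i` the maps `V k i` are bounded by `R i` on the compact set `T i` and `L i`-Lipschitz
there, uniformly in `k`, then along ONE subsequence all of them converge uniformly on the
respective `T i` (Arzelà–Ascoli on each `T i`, Tychonoff, sequential compactness of the countable
product of compact metric spaces). -/
theorem ascoli_aux_extract {ι X : Type*} [Countable ι] [PseudoMetricSpace X]
    {Y : ι → Type*} [∀ i, NormedAddCommGroup (Y i)] [∀ i, ProperSpace (Y i)]
    {T : ι → Set X} (hT : ∀ i, IsCompact (T i)) (V : ℕ → ∀ i, X → Y i) {R L : ι → ℝ}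
    (hL : ∀ i, 0 ≤ L i) (hR : ∀ i k, ∀ z ∈ T i, ‖V k i z‖ ≤ R i)
    (hV : ∀ i k, ∀ z ∈ T i, ∀ z' ∈ T i, dist (V k i z) (V k i z') ≤ L i * dist z z') :
    ∃ φ : ℕ → ℕ, StrictMono φ ∧ ∀ i, ∃ W : X → Y i,
      TendstoUniformlyOn (fun k => V (φ k) i) W atTop (T i) := by
  -- adapted from Literature.Analysis.FluidPDE.exists_strictMono_tendstoUniformlyOn_of_bound
  classical
  haveI : ∀ i, CompactSpace (T i) := fun i => isCompact_iff_compactSpace.1 (hT i)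
  -- the compact sets of bounded continuous functions on the `T i` cut out by the bounds
  let S : ∀ i, Set (T i →ᵇ Y i) := fun i =>
    {g | (∀ x, ‖g x‖ ≤ R i) ∧ ∀ x y, dist (g x) (g y) ≤ L i * dist x y}
  have hS : ∀ i, IsCompact (S i) := by
    intro i
    refine BoundedContinuousFunction.arzela_ascoli₂ (closedBall (0 : Y i) (R i))
      (isCompact_closedBall 0 (R i)) (S i) ?_ (fun g x hg => mem_closedBall_zero_iff.2 (hg.1 x)) ?_
    · have h1 : IsClosed {g : T i →ᵇ Y i | ∀ x, ‖g x‖ ≤ R i} := by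
        have heq : {g : T i →ᵇ Y i | ∀ x, ‖g x‖ ≤ R i} = ⋂ x, {g | ‖g x‖ ≤ R i} := by
          ext g
          simp
        rw [heq]
        exact isClosed_iInter fun x =>
          isClosed_le (continuous_eval_const x).norm continuous_const
      have h2 : IsClosed {g : T i →ᵇ Y i | ∀ x y, dist (g x) (g y) ≤ L i * dist x y} := by
        have heq : {g : T i →ᵇ Y i | ∀ x y, dist (g x) (g y) ≤ L i * dist x y} =
            ⋂ x, ⋂ y, {g | dist (g x) (g y) ≤ L i * dist x y} := by
          ext g
          simp
        rw [heq]
        exact isClosed_iInter fun x => isClosed_iInter fun y =>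
          isClosed_le ((continuous_eval_const x).dist (continuous_eval_const y)) continuous_const
      exact h1.inter h2
    · refine Metric.equicontinuous_of_continuity_modulus (fun d => L i * d) ?_ _ ?_
      · simpa using (tendsto_id.const_mul (L i) : Tendsto (fun d : ℝ => L i * d) (𝓝 0) (𝓝 (L i * 0)))
      · rintro x y ⟨g, hg⟩
        exact hg.2 x y
  have hSpi : IsCompact (Set.pi univ S) := isCompact_univ_pi hS
  -- the `V k i` are continuous on `T i` (they are Lipschitz there)
  have hcont : ∀ i k, ContinuousOn (V k i) (T i) := by
    intro i k
    refine (LipschitzOnWith.of_dist_le_mul (K := (L i).toNNReal) fun z hz z' hz' => ?_).continuousOn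
    rw [Real.coe_toNNReal _ (hL i)]
    exact hV i k z hz z' hz'
  -- the restrictions of the `V k i` to the `T i` as bounded continuous functions
  let F : ℕ → ∀ i, (T i →ᵇ Y i) := fun k i =>
    BoundedContinuousFunction.mkOfCompact
      ⟨(T i).restrict (V k i), continuousOn_iff_continuous_restrict.1 (hcont i k)⟩
  have hFV : ∀ k i (x : T i), F k i x = V k i x := fun k i x => rfl
  have hF : ∀ k, F k ∈ Set.pi univ S := by
    intro k i _
    refine ⟨fun x => ?_, fun x y => ?_⟩
    · rw [hFV]
      exact hR i k x x.2
    · rw [hFV, hFV]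
      exact hV i k x x.2 y y.2
  -- one subsequence for all `i` at once: sequential compactness of the product
  obtain ⟨Glim, -, φ, hφ, hlim⟩ := hSpi.tendsto_subseq hF
  refine ⟨φ, hφ, fun i => ?_⟩
  have hn : TendstoUniformly (fun j => ⇑(F (φ j) i)) (⇑(Glim i)) atTop :=
    BoundedContinuousFunction.tendsto_iff_tendstoUniformly.1
      (((continuous_apply i).tendsto Glim).comp hlim)
  refine ⟨fun z => if hz : z ∈ T i then Glim i ⟨z, hz⟩ else 0, ?_⟩
  rw [tendstoUniformlyOn_iff_tendstoUniformly_comp_coe]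
  have hWG : ((fun z => if hz : z ∈ T i then Glim i ⟨z, hz⟩ else 0) ∘ ((↑) : T i → X)) =
      ⇑(Glim i) :=
    funext fun x => by simp only [comp_apply, dif_pos x.2]
  rw [hWG]
  exact hn

/-! ### Equicontinuity of the derivatives from a bound on the next derivative -/

/-- On a convex subset `s` of an open set `U` of smoothness, a bound `C` on `D^{m+1} f` over `s`
makes `D^m f` `C`-Lipschitz on `s` (mean value inequality; the derivative of `D^m f` is
`D^{m+1} f` curried, with the same norm). -/
theorem ascoli_aux_dist_iteratedFDeriv_le {P G : Type*} [NormedAddCommGroup P] [NormedSpace ℝ P]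
    [NormedAddCommGroup G] [NormedSpace ℝ G] {U s : Set P} (hU : IsOpen U) (hs : Convex ℝ s)
    (hsU : s ⊆ U) {f : P → G} (hf : ContDiffOn ℝ (⊤ : ℕ∞) f U) {m : ℕ} {C : ℝ}
    (hC : ∀ z ∈ s, ‖iteratedFDeriv ℝ (m + 1) f z‖ ≤ C) {z z' : P} (hz : z ∈ s) (hz' : z' ∈ s) :
    dist (iteratedFDeriv ℝ m f z) (iteratedFDeriv ℝ m f z') ≤ C * dist z z' := by
  have hder : ∀ x ∈ s, HasFDerivWithinAt (iteratedFDeriv ℝ m f)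
      (iteratedFDeriv ℝ (m + 1) f x).curryLeft s x := fun x hx =>
    (Literature.Analysis.Calculus.hasFDerivAt_iteratedFDeriv_of_contDiffOn hU hf
      (WithTop.coe_lt_top m) (hsU hx)).hasFDerivWithinAt
  have hbd : ∀ x ∈ s, ‖(iteratedFDeriv ℝ (m + 1) f x).curryLeft‖ ≤ C := fun x hx => by
    rw [ContinuousMultilinearMap.curryLeft_norm]
    exact hC x hx
  rw [dist_eq_norm, dist_eq_norm]
  exact hs.norm_image_sub_le_of_norm_hasFDerivWithin_le hder hbd hz' hz

/-! ### The exhaustion of `Ioi a ×ˢ univ` -/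

/-- Every compact subset of the open half-space `Ioi a ×ˢ univ ⊆ ℝ × E` lies in the open core
`(a + 1/(j+2), a + j + 2) × B(0, j+2)` of some exhaustion piece (it is bounded and its times stay
a positive distance above `a`). -/
theorem ascoli_aux_exists_subset {E : Type*} [NormedAddCommGroup E] (a : ℝ) {K : Set (ℝ × E)}
    (hK : IsCompact K) (hKO : K ⊆ Ioi a ×ˢ univ) :
    ∃ j : ℕ, K ⊆ Ioo (a + 1 / ((j : ℝ) + 2)) (a + (j : ℝ) + 2) ×ˢ ball (0 : E) ((j : ℝ) + 2) := by
  obtain ⟨r, hr⟩ := hK.isBounded.subset_closedBall 0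
  obtain ⟨a', haa', ha'⟩ := hK.exists_forall_le' continuous_fst.continuousOn
    (fun z hz => show a < z.1 from (hKO hz).1)
  have hδ : 0 < a' - a := sub_pos.2 haa'
  obtain ⟨j, hj⟩ := exists_nat_ge (max (1 / (a' - a)) (max (r - a) r))
  have hj1 : 1 / (a' - a) ≤ j := (le_max_left _ _).trans hj
  have hj2 : r - a ≤ j := ((le_max_left _ _).trans (le_max_right _ _)).trans hj
  have hj3 : r ≤ j := ((le_max_right _ _).trans (le_max_right _ _)).trans hj
  refine ⟨j, fun z hz => ?_⟩
  have hzr : ‖z‖ ≤ r := by simpa [mem_closedBall, dist_zero_right] using hr hz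
  have hz1 : z.1 ≤ r := by
    have h := (norm_fst_le z).trans hzr
    rw [Real.norm_eq_abs] at h
    exact (le_abs_self _).trans h
  have hz2 : ‖z.2‖ ≤ r := (norm_snd_le z).trans hzr
  have hsmall : 1 / ((j : ℝ) + 2) < a' - a := by
    rw [div_lt_iff₀ (by positivity)]
    have h1 : 1 / (a' - a) * (a' - a) = 1 := div_mul_cancel₀ _ hδ.ne'
    nlinarith
  have hmin := ha' z hz
  refine ⟨⟨?_, ?_⟩, ?_⟩
  · show a + 1 / ((j : ℝ) + 2) < z.1
    linarith
  · show z.1 < a + (j : ℝ) + 2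
    linarith
  · rw [mem_ball, dist_zero_right]
    linarith

/-! ### The general extraction theorem on an exhausted open set -/

/-- **Arzelà–Ascoli with all derivatives, general form.** Let `O` be an open subset of a
finite-dimensional space `P`, exhausted by compact convex pieces `K j ⊆ O` with open cores
`U j ⊆ K j` such that every compact subset of `O` lies in some `U j`.  A sequence of `C^∞` maps
`f n : P → G` (`G` finite-dimensional) with `‖D^m (f n)‖ ≤ C m` on `O` for all `m, n` has a
subsequence converging with all derivatives, uniformly on compact subsets of `O`, to a `C^∞` map
with the same bounds. -/
theorem ascoli_aux_general {P G : Type*} [NormedAddCommGroup P] [NormedSpace ℝ P]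
    [FiniteDimensional ℝ P] [NormedAddCommGroup G] [NormedSpace ℝ G] [FiniteDimensional ℝ G]
    {O : Set P} (K U : ℕ → Set P) (hKc : ∀ j, IsCompact (K j))
    (hKconv : ∀ j, Convex ℝ (K j)) (hKO : ∀ j, K j ⊆ O) (hUo : ∀ j, IsOpen (U j))
    (hUK : ∀ j, U j ⊆ K j) (hex : ∀ S : Set P, IsCompact S → S ⊆ O → ∃ j, S ⊆ U j)
    (f : ℕ → P → G) (hO : IsOpen O) (hf : ∀ n, ContDiffOn ℝ (⊤ : ℕ∞) (f n) O)
    (hb : ∀ m : ℕ, ∃ C : ℝ, ∀ n, ∀ z ∈ O, ‖iteratedFDeriv ℝ m (f n) z‖ ≤ C) :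
    ∃ φ : ℕ → ℕ, StrictMono φ ∧ ∃ g : P → G, ContDiffOn ℝ (⊤ : ℕ∞) g O ∧
      (∀ m : ℕ, ∃ C : ℝ, ∀ z ∈ O, ‖iteratedFDeriv ℝ m g z‖ ≤ C) ∧
      ∀ (m : ℕ) (S : Set P), IsCompact S → S ⊆ O →
        TendstoUniformlyOn (fun n => iteratedFDeriv ℝ m (f (φ n))) (iteratedFDeriv ℝ m g)
          atTop S := by
  classical
  choose C hC using hb
  -- Step 1: one subsequence along which every `D^m (f (φ n))` converges uniformly on every `K j`
  haveI : ∀ i : ℕ × ℕ, ProperSpace (P [×i.1]→L[ℝ] G) := fun i => by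
    haveI : FiniteDimensional ℝ (P [×i.1]→L[ℝ] G) := ascoli_aux_finiteDimensional
    infer_instance
  obtain ⟨φ, hφ, hW⟩ := ascoli_aux_extract (ι := ℕ × ℕ) (Y := fun i => P [×i.1]→L[ℝ] G)
    (T := fun i => K i.2) (fun i => hKc i.2) (fun k i => iteratedFDeriv ℝ i.1 (f k))
    (R := fun i => C i.1) (L := fun i => max (C (i.1 + 1)) 0) (fun i => le_max_right _ _)
    (fun i k z hz => hC i.1 k z (hKO i.2 hz))
    (fun i k z hz z' hz' => ascoli_aux_dist_iteratedFDeriv_le hO (hKconv i.2) (hKO i.2) (hf k)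
      (fun x hx => (hC (i.1 + 1) k x (hKO i.2 hx)).trans (le_max_left _ _)) hz hz')
  -- Step 2: the pointwise limits of the derivatives, as Taylor fields
  have hmemU : ∀ z ∈ O, ∃ j, z ∈ U j := fun z hz => by
    obtain ⟨j, hj⟩ := hex {z} isCompact_singleton (singleton_subset_iff.2 hz)
    exact ⟨j, hj (mem_singleton z)⟩
  have hpt : ∀ m, ∀ z ∈ O, ∃ q : P [×m]→L[ℝ] G,
      Tendsto (fun n => iteratedFDeriv ℝ m (f (φ n)) z) atTop (𝓝 q) := by
    intro m z hz
    obtain ⟨j, hj⟩ := hmemU z hz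
    obtain ⟨W, hW'⟩ := hW (m, j)
    exact ⟨W z, hW'.tendsto_at (hUK j hj)⟩
  choose! q hq using hpt
  -- uniform convergence on each `K j` towards the pointwise limits
  have hunifK : ∀ m j, TendstoUniformlyOn (fun n x => iteratedFDeriv ℝ m (f (φ n)) x)
      (fun x => q m x) atTop (K j) := by
    intro m j
    obtain ⟨W, hW'⟩ := hW (m, j)
    refine hW'.congr_right fun z hz => ?_
    exact tendsto_nhds_unique (hW'.tendsto_at hz) (hq m z (hKO j hz))
  -- the hypotheses of the tree's `ContDiffUniformLimit` on each open core `U j`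
  have hfU : ∀ j n, ContDiffOn ℝ (⊤ : ℕ∞) (f (φ n)) (U j) := fun j n =>
    (hf (φ n)).mono ((hUK j).trans (hKO j))
  have hlimU : ∀ j, ∀ m : ℕ, (m : ℕ∞) ≤ ⊤ →
      TendstoUniformlyOn (fun n x => iteratedFDeriv ℝ m (f (φ n)) x)
        (fun x => (fun (y : P) (k : ℕ) => q k y) x m) atTop (U j) :=
    fun j m _ => (hunifK m j).mono (hUK j)
  have hgU : ∀ j, ∀ x ∈ U j, Tendsto (fun n => f (φ n) x) atTop (𝓝 (q 0 x 0)) := by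
    intro j x hx
    have h0 := (hunifK 0 j).tendsto_at (hUK j hx)
    have h0' := ((ContinuousMultilinearMap.apply ℝ (fun _ : Fin 0 => P) G 0).continuous.tendsto
      _).comp h0
    have heq : (⇑(ContinuousMultilinearMap.apply ℝ (fun _ : Fin 0 => P) G 0) ∘
        fun n => iteratedFDeriv ℝ 0 (f (φ n)) x) = fun n => f (φ n) x := by
      funext n
      simp
    rw [heq] at h0'
    simpa using h0'
  have hgC : ∀ j, ContDiffOn ℝ (⊤ : ℕ∞) (fun x => q 0 x 0) (U j) := fun j =>
    Literature.Analysis.Calculus.contDiffOn_of_tendstoUniformlyOn_iteratedFDeriv (hUo j) (hfU j)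
      (hlimU j) (hgU j)
  -- Step 3: conclusions (all local on the `U j`)
  refine ⟨φ, hφ, fun x => q 0 x 0, ?_, ?_, ?_⟩
  · intro z hz
    obtain ⟨j, hj⟩ := hmemU z hz
    exact ((hgC j).contDiffAt ((hUo j).mem_nhds hj)).contDiffWithinAt
  · intro m
    refine ⟨C m, fun z hz => ?_⟩
    obtain ⟨j, hj⟩ := hmemU z hz
    exact Literature.Analysis.Calculus.norm_iteratedFDeriv_le_of_tendstoUniformlyOn (hUo j) (hfU j)
      (hlimU j) (hgU j) le_top hj (Eventually.of_forall fun n => hC m (φ n) z hz)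
  · intro m S hS hSO
    obtain ⟨j, hj⟩ := hex S hS hSO
    exact (Literature.Analysis.Calculus.tendstoUniformlyOn_iteratedFDeriv_of_tendstoUniformlyOn
      (hUo j) (hfU j) (hlimU j) (hgU j) le_top).mono hj

/-! ### The registered stub -/

/-- Stub B4 **ASCOLI WITH ALL DERIVATIVES** (registered signature, verbatim): a sequence of `C^∞`
maps into a finite-dimensional space whose derivatives of every order are bounded on
`Ioi a ×ˢ univ` uniformly in `n` has a subsequence converging, with all derivatives and uniformly
on every compact subset, to a `C^∞` map obeying the same bounds (Dieudonné 1960, (7.5.7),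
(8.6.3)): `ascoli_aux_general` on the exhaustion `[a + 1/(j+2), a + j + 2] × B̄(0, j+2)` with
open cores `(a + 1/(j+2), a + j + 2) × B(0, j+2)`. -/
theorem stub_ascoliSmooth :
    ∀ {G : Type} [NormedAddCommGroup G] [NormedSpace ℝ G] [FiniteDimensional ℝ G]
      (a : ℝ) (f : ℕ → ℝ × EuclideanSpace ℝ (Fin 3) → G),
      (∀ n, ContDiffOn ℝ (⊤ : ℕ∞) (f n) (Set.Ioi a ×ˢ Set.univ)) →
      (∀ m : ℕ, ∃ C : ℝ, ∀ n, ∀ z ∈ Set.Ioi a ×ˢ (Set.univ : Set (EuclideanSpace ℝ (Fin 3))),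
          ‖iteratedFDeriv ℝ m (f n) z‖ ≤ C) →
      ∃ φ : ℕ → ℕ, StrictMono φ ∧ ∃ g : ℝ × EuclideanSpace ℝ (Fin 3) → G,
        ContDiffOn ℝ (⊤ : ℕ∞) g (Set.Ioi a ×ˢ Set.univ) ∧
        (∀ m : ℕ, ∃ C : ℝ, ∀ z ∈ Set.Ioi a ×ˢ (Set.univ : Set (EuclideanSpace ℝ (Fin 3))),
            ‖iteratedFDeriv ℝ m g z‖ ≤ C) ∧
        ∀ (m : ℕ) (K : Set (ℝ × EuclideanSpace ℝ (Fin 3))), IsCompact K → K ⊆ Set.Ioi a ×ˢ Set.univ →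
          TendstoUniformlyOn (fun n => iteratedFDeriv ℝ m (f (φ n))) (iteratedFDeriv ℝ m g) atTop K := by
  intro G _ _ _ a f hf hb
  have hpos : ∀ j : ℕ, (0 : ℝ) < 1 / ((j : ℝ) + 2) := fun j => by positivity
  exact ascoli_aux_general (O := Ioi a ×ˢ univ)
    (fun j : ℕ => Icc (a + 1 / ((j : ℝ) + 2)) (a + (j : ℝ) + 2) ×ˢ
      closedBall (0 : EuclideanSpace ℝ (Fin 3)) ((j : ℝ) + 2))
    (fun j : ℕ => Ioo (a + 1 / ((j : ℝ) + 2)) (a + (j : ℝ) + 2) ×ˢ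
      ball (0 : EuclideanSpace ℝ (Fin 3)) ((j : ℝ) + 2))
    (fun j => isCompact_Icc.prod (isCompact_closedBall _ _))
    (fun j => (convex_Icc _ _).prod (convex_closedBall _ _))
    (fun j z hz => ⟨lt_of_lt_of_le (lt_add_of_pos_right a (hpos j)) hz.1.1, mem_univ _⟩)
    (fun j => isOpen_Ioo.prod isOpen_ball)
    (fun j => prod_mono Ioo_subset_Icc_self ball_subset_closedBall)
    (fun S hS hSO => ascoli_aux_exists_subset a hS hSO) f (isOpen_Ioi.prod isOpen_univ) hf hb

end Summit.AnomalousDissipation.AnomalousDissipation.Theorems.ChainRealisation.SeparatrixFluxPinning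

end
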